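import Literature.NumberTheory.Automorphic.CompactSubgroupAveraging
import Literature.NumberTheory.Automorphic.ClosedCompactDecomposition
import Mathlib.MeasureTheory.Function.L2Space
import Mathlib.Analysis.InnerProductSpace.LinearMap
import HarnessLib

/-!
# Twisted averages over a compact subgroup: the isotypic projectors and their Bessel inequality

Topic `NumberTheory/Automorphic`; namespace `Literature.NumberTheory.Automorphic`. Groundwork for the
finite-place half of the Kirillov `L²`-bound of the smoothed Whittaker coefficient on `GL_2` (the
`n ≤ 2` case of the named fact `JacquetShalika1981_partialPairL_pole_of_eq_conj`), abstract part.

For a unitary, strongly continuous representation `π` of a topological group `G` on a complex Hilbert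
space `H`, a compact subgroup `J ≤ G` (Haar probability measure `subgroupHaar`,
`CompactSubgroupAveraging`) and a continuous unitary character `χ` of `J`, the **twisted average**

  `E v = ∫_J χ̄(j) π(j) v dj`   (`twistedAverage`)

is the orthogonal projection onto the `χ`-isotypic vectors: `π(j₀) E v = χ(j₀) E v`
(`rep_twistedAverage`), `E (E v) = E v`, `⟪E v, w⟫ = ⟪v, E w⟫` (inversion invariance of the Haar
measure of a compact group, `isInvInvariant_of_compactSpace`), `‖E v‖ ≤ ‖v‖` and
`‖E v‖² = re ⟪E v, v⟫`. The file also records the two elementary Hilbert-space facts used to sum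
such projectors over the shells of the Kirillov model: vectors transforming under one group element
by different unitary scalars are orthogonal (`inner_eq_zero_of_rep_smul_ne`), and a finite family of
maps `E_m` with `‖E_m v‖² = re ⟪E_m v, v⟫` and pairwise orthogonal values satisfies Bessel's
inequality `∑_m ‖E_m v‖² ≤ ‖v‖²` (`sum_norm_sq_le_of_pairwise_inner_eq_zero`). All proofs complete;
no named facts (Bump (1997), §4.4, the idempotents `e_{K,χ}` of the Hecke algebra; standard).

## References

* D. Bump, *Automorphic Forms and Representations*, Cambridge Studies in Advanced Mathematics 55,
  CUP (1997), §4.4 [Bump1997].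
-/

noncomputable section

open MeasureTheory Measure Set Filter Topology
open scoped ComplexConjugate InnerProductSpace

namespace Literature.NumberTheory.Automorphic

/-! ### Two Hilbert-space lemmas -/

section Hilbert

variable {H : Type*} [NormedAddCommGroup H] [InnerProductSpace ℂ H]

/-- **Eigenvectors of a unitary operator for different eigenvalues are orthogonal**: if `U` preserves
inner products, `U w = c • w`, `U w' = c' • w'` with `‖c‖ = 1` and `c ≠ c'`, then `⟪w, w'⟫ = 0`. [folklore] -/
theorem inner_eq_zero_of_rep_smul_ne {U : H → H} (hU : ∀ x y, ⟪U x, U y⟫_ℂ = ⟪x, y⟫_ℂ) {w w' : H} {c c' : ℂ}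
    (hw : U w = c • w) (hw' : U w' = c' • w') (hc : ‖c‖ = 1) (hcc' : c ≠ c') : ⟪w, w'⟫_ℂ = 0 := by
  have h := hU w w'
  rw [hw, hw', inner_smul_left, inner_smul_right, ← mul_assoc] at h
  have hc0 : c ≠ 0 := fun h0 => by rw [h0, norm_zero] at hc; exact zero_ne_one hc
  have hne : conj c * c' ≠ 1 := by
    intro h1
    apply hcc'
    have hcc : conj c * c = 1 := by
      rw [← Complex.normSq_eq_conj_mul_self, Complex.normSq_eq_norm_sq, hc, one_pow, Complex.ofReal_one]
    have : conj c * c = conj c * c' := by rw [hcc, h1]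
    exact mul_left_cancel₀ ((map_ne_zero _).2 hc0) this
  have h2 : (conj c * c' - 1) * ⟪w, w'⟫_ℂ = 0 := by rw [sub_mul, one_mul, h, sub_self]
  rcases mul_eq_zero.1 h2 with h3 | h3
  · exact absurd (sub_eq_zero.1 h3) hne
  · exact h3

/-- **Bessel's inequality for a finite family of orthogonal "projector values"**: if
`‖E_m v‖² = re ⟪E_m v, v⟫` for every `m ∈ s` and the vectors `E_m v` (`m ∈ s`) are pairwise
orthogonal, then `∑_{m ∈ s} ‖E_m v‖² ≤ ‖v‖²`. [folklore] -/
theorem sum_norm_sq_le_of_pairwise_inner_eq_zero {ι : Type*} (s : Finset ι) (E : ι → H → H) (v : H)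
    (hE : ∀ m ∈ s, ‖E m v‖ ^ 2 = RCLike.re ⟪E m v, v⟫_ℂ)
    (horth : ∀ m ∈ s, ∀ m' ∈ s, m ≠ m' → ⟪E m v, E m' v⟫_ℂ = 0) :
    ∑ m ∈ s, ‖E m v‖ ^ 2 ≤ ‖v‖ ^ 2 := by
  classical
  set u : H := ∑ m ∈ s, E m v with hu
  -- `‖u‖² = ∑ ‖E_m v‖²`
  have hPyth : ‖u‖ ^ 2 = ∑ m ∈ s, ‖E m v‖ ^ 2 := by
    rw [@norm_sq_eq_re_inner ℂ, hu, sum_inner]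
    rw [_root_.map_sum]
    refine Finset.sum_congr rfl fun m hm => ?_
    rw [inner_sum, Finset.sum_eq_single_of_mem m hm fun m' hm' hne => horth m hm m' hm' hne.symm]
    exact (@norm_sq_eq_re_inner ℂ _ _ _ _ (E m v)).symm
  -- `∑ ‖E_m v‖² = re ⟪u, v⟫ ≤ ‖u‖ ‖v‖`
  have hsum : ∑ m ∈ s, ‖E m v‖ ^ 2 = RCLike.re ⟪u, v⟫_ℂ := by
    rw [hu, sum_inner, _root_.map_sum]
    exact Finset.sum_congr rfl fun m hm => hE m hm
  have hle : ∑ m ∈ s, ‖E m v‖ ^ 2 ≤ ‖u‖ * ‖v‖ :=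
    hsum.trans_le ((re_inner_le_norm u v))
  -- conclude: `S ≤ √S ‖v‖`
  set S := ∑ m ∈ s, ‖E m v‖ ^ 2 with hS
  have hS0 : 0 ≤ S := Finset.sum_nonneg fun m _ => sq_nonneg _
  have huS : ‖u‖ = Real.sqrt S := by rw [← hPyth, Real.sqrt_sq (norm_nonneg _)]
  rw [huS] at hle
  by_cases hS0' : S = 0
  · rw [hS0']; positivity
  · have hpos : 0 < Real.sqrt S := Real.sqrt_pos.2 (lt_of_le_of_ne hS0 (Ne.symm hS0'))
    have h1 : Real.sqrt S * Real.sqrt S ≤ Real.sqrt S * ‖v‖ := by rwa [Real.mul_self_sqrt hS0]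
    have h2 : Real.sqrt S ≤ ‖v‖ := le_of_mul_le_mul_left h1 hpos
    calc S = Real.sqrt S ^ 2 := (Real.sq_sqrt hS0).symm
      _ ≤ ‖v‖ ^ 2 := pow_le_pow_left₀ (Real.sqrt_nonneg _) h2 2

end Hilbert

/-! ### The twisted average over a compact subgroup -/

section Twisted

variable {G : Type*} [Group G] [TopologicalSpace G] [IsTopologicalGroup G] [MeasurableSpace G] [BorelSpace G]
variable {H : Type*} [NormedAddCommGroup H] [InnerProductSpace ℂ H] [CompleteSpace H]
variable (J : Subgroup G) (hJ : IsCompact (J : Set G))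
variable (π : G →* (H →L[ℂ] H)) (χ : G → ℂ)

/-- The **twisted average** `E v = ∫_J χ̄(j) π(j) v dj` over a compact subgroup `J` (Haar probability
measure) against a character `χ`. [cite: Bump1997, §4.4] -/
def twistedAverage (v : H) : H :=
  ∫ j : J, (conj (χ j)) • π (j : G) v ∂(subgroupHaar J hJ)

omit [CompleteSpace H] in
/-- Unfolding of `twistedAverage`. [folklore] -/
theorem twistedAverage_def (v : H) :
    twistedAverage J hJ π χ v = ∫ j : J, (conj (χ j)) • π (j : G) v ∂(subgroupHaar J hJ) := rfl

variable {J hJ π χ}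

/-- The hypotheses on `(π, χ)`: `π` unitary and strongly continuous, `χ` a continuous unitary
character of `J`. [folklore] -/
structure IsTwistData (J : Subgroup G) (π : G →* (H →L[ℂ] H)) (χ : G → ℂ) : Prop where
  norm_rep : ∀ g v, ‖π g v‖ = ‖v‖
  continuous_rep : ∀ v, Continuous fun g => π g v
  mul_char : ∀ j ∈ J, ∀ j' ∈ J, χ (j * j') = χ j * χ j'
  norm_char : ∀ j ∈ J, ‖χ j‖ = 1
  continuous_char : Continuous fun j : J => χ j

namespace IsTwistData

variable (h : IsTwistData J π χ)
include h

omit [IsTopologicalGroup G] [MeasurableSpace G] [BorelSpace G] [CompleteSpace H] in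
/-- Auxiliary. [folklore] -/
theorem char_one : χ 1 = 1 := by
  have h1 := h.mul_char 1 J.one_mem 1 J.one_mem
  rw [mul_one] at h1
  have hn : χ 1 ≠ 0 := fun h0 => by have := h.norm_char 1 J.one_mem; rw [h0, norm_zero] at this; exact zero_ne_one this
  calc χ 1 = χ 1 * χ 1 * (χ 1)⁻¹ := by rw [mul_assoc, mul_inv_cancel₀ hn, mul_one]
    _ = χ 1 * (χ 1)⁻¹ := by rw [← h1]
    _ = 1 := mul_inv_cancel₀ hn

omit [IsTopologicalGroup G] [MeasurableSpace G] [BorelSpace G] [CompleteSpace H] in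
/-- Auxiliary. [folklore] -/
theorem char_inv {j : G} (hj : j ∈ J) : χ j⁻¹ = conj (χ j) := by
  have hn : χ j ≠ 0 := fun h0 => by have := h.norm_char j hj; rw [h0, norm_zero] at this; exact zero_ne_one this
  have h1 := h.mul_char j hj j⁻¹ (J.inv_mem hj)
  rw [mul_inv_cancel, h.char_one] at h1
  have hcj : conj (χ j) * χ j = 1 := by
    rw [← Complex.normSq_eq_conj_mul_self, Complex.normSq_eq_norm_sq, h.norm_char j hj, one_pow, Complex.ofReal_one]
  calc χ j⁻¹ = conj (χ j) * χ j * χ j⁻¹ := by rw [hcj, one_mul]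
    _ = conj (χ j) := by rw [mul_assoc, ← h1, mul_one]

omit [IsTopologicalGroup G] [MeasurableSpace G] [BorelSpace G] [CompleteSpace H] in
/-- Auxiliary. [folklore] -/
theorem conj_char_mul_char {j : G} (hj : j ∈ J) : conj (χ j) * χ j = 1 := by
  rw [← Complex.normSq_eq_conj_mul_self, Complex.normSq_eq_norm_sq, h.norm_char j hj, one_pow, Complex.ofReal_one]

omit [IsTopologicalGroup G] [MeasurableSpace G] [BorelSpace G] [CompleteSpace H] in
/-- Auxiliary. [folklore] -/
theorem inner_rep_rep (g : G) (x y : H) : ⟪π g x, π g y⟫_ℂ = ⟪x, y⟫_ℂ :=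
  (LinearMap.norm_map_iff_inner_map_map (π g)).1 (h.norm_rep g) x y

omit [IsTopologicalGroup G] [MeasurableSpace G] [BorelSpace G] [CompleteSpace H] in
/-- `π(a b) v = π(a) (π(b) v)`. [folklore] -/
theorem rep_mul_apply (a b : G) (v : H) : π (a * b) v = π a (π b v) := by
  have := h.norm_rep
  rw [map_mul]; rfl

omit [IsTopologicalGroup G] [MeasurableSpace G] [BorelSpace G] [CompleteSpace H] in
/-- `⟪π(g) x, y⟫ = ⟪x, π(g⁻¹) y⟫`. [folklore] -/
theorem inner_rep_left (g : G) (x y : H) : ⟪π g x, y⟫_ℂ = ⟪x, π g⁻¹ y⟫_ℂ := by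
  have h1 := h.inner_rep_rep g x (π g⁻¹ y)
  rw [← h.rep_mul_apply, mul_inv_cancel, map_one] at h1
  exact h1

omit [IsTopologicalGroup G] [MeasurableSpace G] [BorelSpace G] [CompleteSpace H] in
/-- Auxiliary. [folklore] -/
theorem continuous_integrand (v : H) : Continuous fun j : J => (conj (χ j)) • π (j : G) v :=
  (Complex.continuous_conj.comp h.continuous_char).smul ((h.continuous_rep v).comp continuous_subtype_val)

omit [CompleteSpace H] in
/-- Auxiliary. [folklore] -/
theorem integrable_integrand (v : H) : Integrable (fun j : J => (conj (χ j)) • π (j : G) v) (subgroupHaar J hJ) := by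
  haveI := compactSpace_subgroup J hJ
  exact (h.continuous_integrand v).integrable_of_hasCompactSupport (HasCompactSupport.of_compactSpace _)

omit [CompleteSpace H] in
/-- `‖E v‖ ≤ ‖v‖`. [folklore] -/
theorem norm_twistedAverage_le (v : H) : ‖twistedAverage J hJ π χ v‖ ≤ ‖v‖ := by
  rw [twistedAverage_def]
  refine (norm_integral_le_integral_norm _).trans ?_
  have hpt : ∀ j : J, ‖(conj (χ j)) • π (j : G) v‖ = ‖v‖ := fun j => by
    rw [norm_smul, RCLike.norm_conj, h.norm_char j j.2, one_mul, h.norm_rep]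
  simp_rw [hpt, integral_const, smul_eq_mul]
  rw [probReal_univ, one_mul]

/-- **Equivariance**: `π(j₀) E v = χ(j₀) E v` for `j₀ ∈ J`. [cite: Bump1997, §4.4] -/
theorem rep_twistedAverage {j₀ : G} (hj₀ : j₀ ∈ J) (v : H) :
    π j₀ (twistedAverage J hJ π χ v) = χ j₀ • twistedAverage J hJ π χ v := by
  rw [twistedAverage_def, ← ContinuousLinearMap.integral_comp_comm _ (h.integrable_integrand v)]
  have h1 : (fun j : J => π j₀ ((conj (χ j)) • π (j : G) v)) =
      fun j : J => χ j₀ • ((fun j' : J => (conj (χ j')) • π (j' : G) v) (⟨j₀, hj₀⟩ * j)) := by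
    funext j
    simp only [Subgroup.coe_mul]
    rw [ContinuousLinearMap.map_smul, ← h.rep_mul_apply, map_mul, smul_smul,
      h.mul_char j₀ hj₀ j j.2, map_mul, ← mul_assoc,
      show χ j₀ * conj (χ j₀) = 1 by rw [mul_comm]; exact h.conj_char_mul_char hj₀, one_mul]
  rw [h1, integral_smul]
  congr 1
  exact integral_mul_left_eq_self (μ := subgroupHaar J hJ) (fun j' : J => (conj (χ j')) • π (j' : G) v) ⟨j₀, hj₀⟩

/-- **Idempotence**: `E (E v) = E v`. [cite: Bump1997, §4.4] -/
theorem twistedAverage_twistedAverage (v : H) :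
    twistedAverage J hJ π χ (twistedAverage J hJ π χ v) = twistedAverage J hJ π χ v := by
  conv_lhs => rw [twistedAverage_def]
  have h1 : (fun j : J => (conj (χ j)) • π (j : G) (twistedAverage J hJ π χ v)) = fun _ => twistedAverage J hJ π χ v := by
    funext j
    rw [h.rep_twistedAverage j.2, smul_smul, h.conj_char_mul_char j.2, one_smul]
  rw [h1, integral_const, probReal_univ, one_smul]

/-- **Self-adjointness**: `⟪E v, w⟫ = ⟪v, E w⟫` (unitarity of `π`, `χ(j⁻¹) = χ̄(j)` and the
inversion invariance of the Haar measure of the compact group `J`). [cite: Bump1997, §4.4] -/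
theorem inner_twistedAverage_left [T2Space G] [SecondCountableTopology G] (v w : H) :
    ⟪twistedAverage J hJ π χ v, w⟫_ℂ = ⟪v, twistedAverage J hJ π χ w⟫_ℂ := by
  haveI := compactSpace_subgroup J hJ
  haveI : SecondCountableTopology ↥J := TopologicalSpace.Subtype.secondCountableTopology _
  haveI : (subgroupHaar J hJ).IsInvInvariant := isInvInvariant_of_compactSpace _
  rw [twistedAverage_def, twistedAverage_def, ← inner_conj_symm, ← integral_inner (h.integrable_integrand v),
    ← integral_inner (h.integrable_integrand w)]
  rw [← integral_conj]
  rw [← integral_inv_eq_self (fun j : J => ⟪v, (conj (χ j)) • π (j : G) w⟫_ℂ) (subgroupHaar J hJ)]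
  refine integral_congr_ae (ae_of_all _ fun j => ?_)
  simp only [Subgroup.coe_inv]
  rw [inner_smul_right, inner_smul_right, map_mul, Complex.conj_conj, inner_conj_symm, h.char_inv j.2,
    Complex.conj_conj, h.inner_rep_left]

/-- `‖E v‖² = re ⟪E v, v⟫`. [folklore] -/
theorem norm_sq_twistedAverage [T2Space G] [SecondCountableTopology G] (v : H) :
    ‖twistedAverage J hJ π χ v‖ ^ 2 = RCLike.re ⟪twistedAverage J hJ π χ v, v⟫_ℂ := by
  rw [@norm_sq_eq_re_inner ℂ, ← h.inner_twistedAverage_left, h.twistedAverage_twistedAverage]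

/-- **Conjugated projectors**: for `a ∈ G`, the vector `E (π(a) v)` is `π(a)` applied to a vector `w`
with `π(a⁻¹ j a) w = χ(j) w` for all `j ∈ J` — namely `w = π(a⁻¹) E (π(a) v)`, and
`‖E (π a v)‖ = ‖w‖`. [folklore] -/
theorem rep_conj_smul_of_twistedAverage (a : G) {j : G} (hj : j ∈ J) (v : H) :
    π (a⁻¹ * j * a) (π a⁻¹ (twistedAverage J hJ π χ (π a v))) = χ j • π a⁻¹ (twistedAverage J hJ π χ (π a v)) := by
  rw [← h.rep_mul_apply, mul_assoc, mul_assoc, mul_inv_cancel, mul_one, h.rep_mul_apply,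
    h.rep_twistedAverage hj, ContinuousLinearMap.map_smul]

omit [IsTopologicalGroup G] [MeasurableSpace G] [BorelSpace G] [CompleteSpace H] in
/-- Auxiliary. [folklore] -/
theorem norm_rep_inv_apply (a : G) (w : H) : ‖π a⁻¹ w‖ = ‖w‖ := h.norm_rep a⁻¹ w

end IsTwistData

end Twisted

end Literature.NumberTheory.Automorphic
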